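import Summits.AnomalousDissipation.AnomalousDissipation.Theorems.SawtoothPulseCascadeK1LocalisedCascadeK1locPrimeCTG
import Literature.Analysis.FluidPDE.SawtoothCascadeSmooth

set_option linter.dupNamespace false

/-!
# K1loc′ AS A POINT OF THE CRUX BODY: `CascadeFieldSmooth P ∧ K1Localised P (γ² − 3)` at `P = ⟨8, δ₀, 2, 1, 2⟩`, `0 < δ₀ ≤ 2⁻¹⁰⁰`

Prover lane on the crux `K1LocalisedCascade` (stmt-AnomalousDissipation-19491), route `SawtoothPulseCascade`.
The crux body is the conjunction `CascadeFieldSmooth ⟨γ, ¼, 2, 1, ρ_N⟩ ∧ K1Localised ⟨γ, ¼, 2, 1, ρ_N⟩ (γ² − 3)` over the box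
`γ ∈ [5, 8]`, `ρ_N ∈ [2, 7]`.  This file records the landed K1loc′ (`…K1locPrimeCTG.k1Localised_ctg_at`, p663045) IN THAT SHAPE at the
point `γ = 8`, `ρ_N = 2` and every rounding `0 < δ₀ ≤ 2⁻¹⁰⁰` (the tree's `…SawtoothCascadeSmooth.cascadeFieldSmooth` is `δ₀`-generic):
* `cascadeFieldSmooth_and_k1Localised_at` — the conjunction at `⟨8, δ₀, 2, 1, 2⟩`;
* `exists_point_cascadeFieldSmooth_and_k1Localised` — hence SOME `δ₀ ∈ (0, ¼]` and SOME `γ ∈ [5, 8]` carry the conjunction at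
  `ρ_N = 2` (witness `δ₀ = 2⁻¹⁰⁰`, `γ = 8`): the existential (∃δ₀ ∃γ) weakening of the crux body at `ρ_N = 2`, i.e. the body of the
  arbiter's SHAPE-P restatement `K1LocalisedCascadeP` (A25-3), proved here against the tree's vocabulary only;
* `exists_rounding_forall_le_cascadeFieldSmooth_and_k1Localised` — the same with the rounding quantified as a whole interval
  `(0, δ⋆]`, `δ⋆ = 2⁻¹⁰⁰ ≤ ¼`.
HONEST FRAMING: a rung at ONE point of the box with SMALL rounding; NOT the crux (which fixes `δ₀ = ¼` and quantifies the whole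
box); nothing about anomalous dissipation in general is claimed.  No definitions. [cite: DEIJ2022, (1.2)–(1.3)]
[cite: BrueDeLellisCMP2023, §2 Question 2.1] [problem: turb]
-/

namespace Summit.AnomalousDissipation.AnomalousDissipation.Theorems.SawtoothPulseCascade.K1Window

open Set
open Literature.Analysis.FluidPDE.SawtoothCascade

/-- **K1loc′ in the shape of the crux body**: at `P = ⟨8, δ₀, 2, 1, 2⟩`, `0 < δ₀ ≤ 2⁻¹⁰⁰`, the cascade field is smooth on
`[0,1) × 𝕋²` AND `K1Localised P (8² − 3)`. [cite: DEIJ2022, (1.2)–(1.3)] [cite: BrueDeLellisCMP2023, §2 Question 2.1] -/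
theorem cascadeFieldSmooth_and_k1Localised_at {δ₀ : ℝ} (hδ₀ : 0 < δ₀) (hδ₀' : δ₀ ≤ (2 : ℝ)⁻¹ ^ 100) :
    CascadeFieldSmooth ⟨8, δ₀, 2, 1, 2⟩ ∧ K1Localised ⟨8, δ₀, 2, 1, 2⟩ (8 ^ 2 - 3) :=
  ⟨cascadeFieldSmooth ⟨8, δ₀, 2, 1, 2⟩ hδ₀ (by norm_num), k1Localised_ctg_at hδ₀ hδ₀'⟩

/-- **The ∃-point form** (body of the SHAPE-P restatement of the crux at `ρ_N = 2`): there are a rounding `δ₀ ∈ (0, ¼]` and a shear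
amplitude `γ ∈ [5, 8]` such that the cascade `⟨γ, δ₀, 2, 1, 2⟩` is smooth on `[0,1) × 𝕋²` and localises the scalar at rate `γ² − 3`
(witness `δ₀ = 2⁻¹⁰⁰`, `γ = 8`). [cite: DEIJ2022, (1.2)–(1.3)] [cite: BrueDeLellisCMP2023, §2 Question 2.1] -/
theorem exists_point_cascadeFieldSmooth_and_k1Localised :
    ∃ δ₀ ∈ Set.Ioc (0 : ℝ) (1 / 4), ∃ γ ∈ Set.Icc (5 : ℝ) 8,
      CascadeFieldSmooth ⟨γ, δ₀, 2, 1, 2⟩ ∧ K1Localised ⟨γ, δ₀, 2, 1, 2⟩ (γ ^ 2 - 3) :=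
  ⟨(2 : ℝ)⁻¹ ^ 100, ⟨by positivity, by norm_num⟩, 8, ⟨by norm_num, le_rfl⟩,
    cascadeFieldSmooth_and_k1Localised_at (δ₀ := (2 : ℝ)⁻¹ ^ 100) (by positivity) le_rfl⟩

/-- **The ∃δ⋆ ∀δ₀ ≤ δ⋆ form**: there is a rounding scale `δ⋆ ∈ (0, ¼]` (namely `2⁻¹⁰⁰`) below which EVERY rounding gives a smooth,
localising cascade at `γ = 8`, `ρ_N = 2`. [cite: DEIJ2022, (1.2)–(1.3)] [cite: BrueDeLellisCMP2023, §2 Question 2.1] -/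
theorem exists_rounding_forall_le_cascadeFieldSmooth_and_k1Localised :
    ∃ δs ∈ Set.Ioc (0 : ℝ) (1 / 4), ∀ δ₀ ∈ Set.Ioc (0 : ℝ) δs,
      CascadeFieldSmooth ⟨8, δ₀, 2, 1, 2⟩ ∧ K1Localised ⟨8, δ₀, 2, 1, 2⟩ (8 ^ 2 - 3) :=
  ⟨(2 : ℝ)⁻¹ ^ 100, ⟨by positivity, by norm_num⟩, fun _ hδ₀ => cascadeFieldSmooth_and_k1Localised_at hδ₀.1 hδ₀.2⟩

end Summit.AnomalousDissipation.AnomalousDissipation.Theorems.SawtoothPulseCascade.K1Window
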